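import Summits.ResolutionOfSingularities.ResolutionOfSingularities.Theses.PAlteration
import Summits.ResolutionOfSingularities.ResolutionOfSingularities.Theorems.PAlterationPicoverFunctionFieldNormalizationIn
import Summits.ResolutionOfSingularities.ResolutionOfSingularities.Theorems.PAlterationPicoverOfNormalizationIn
import Summits.ResolutionOfSingularities.ResolutionOfSingularities.Theorems.PAlterationPicoverBaseCase
import Literature.AlgebraicGeometry.Resolution.NormalizationInExtension
import Literature.AlgebraicGeometry.Resolution.ProjectiveSpaceRegular
import Literature.AlgebraicGeometry.Motives.FunctionFieldOver
import Literature.AlgebraicGeometry.Motives.RatFnSpec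

/-!
# The local model `t^p = a` from the degree-`p` residue (sub-goal
# `picoverLocalModel_of_picoverDegP` of the line `degree-p-tower` of the crux `Picover`)

**Statement.** Assume the degree-`p` residue of the line `degree-p-tower` of the crux
`Summit.ResolutionOfSingularities.ResolutionOfSingularities.Theses.PAlteration.Picover`: for every
prime `p`, field `k` of characteristic `p`, regular integral separated finite-type `k`-scheme `W`
and purely inseparable extension `L ⊇ K(W)` of degree `p`, the normalization `W^L` of `W` in `L`
has a resolution of singularities. Then the rank-5 item
`Summit.ResolutionOfSingularities.ResolutionOfSingularities.Theses.PAlteration.PicoverLocalModel`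
holds: for `R` a regular finitely generated `k`-domain and `a ∈ R`, the reduced hypersurface
`X_a = Spec (R[T]/(T^p - a))_red = Spec (AdjoinRoot (X^p - C a) ⧸ nilradical _)` has a resolution.

**Proof.** Put `S = R[T]/(T^p - a)`, `Q = S/nil(S)`, `Y = Spec R`, `X_a = Spec Q`,
`g = Spec (R → Q) : X_a → Y`.
* `Q` is a domain (`isPrime_nilradical_adjoinRoot`): by Frobenius every `s ∈ S` has
  `s^p ∈ R` (`exists_pow_eq_of`: `(Σ cᵢ tⁱ)^p = Σ cᵢ^p aⁱ`); mapping `S → Ω` into an algebraic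
  closure `Ω` of `Frac R` by `T ↦ a^{1/p}`, the kernel is exactly the nilradical (if `s ↦ 0`
  then `s^p ∈ R` maps to `0`, so `s^p = 0`), and kernels of maps to domains are prime.
* `g` is finite (`Q` is a quotient of the free rank-`p` module `S`) and dominant (`R → Q` is
  injective), `Y` is regular (`Scheme.isRegular_Spec`), affine of finite type over `k`.
* `K(X_a) = Frac Q` is generated over `K(Y) = Frac R` by the class `x` of `T`, and
  `x^p = a ∈ K(Y)` (`RatFn.functionFieldMap_SpecMap` identifies `g^♯` with `R → Q` on
  elements). Hence (`isPurelyInseparable_and_finrank_of_pow_mem`) `K(X_a)/K(Y)` is purely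
  inseparable (Mathlib `IntermediateField.isPurelyInseparable_adjoin_simple_iff_pow_mem`) of
  degree `[K(Y)(x) : K(Y)] = deg minpoly(x) ≤ p`, a power of `p`, so of degree `1` or `p`.
* Degree `1`: the landed base case `stub_baseCase`; degree `p`: the residue. Either way the
  normalization of `Y` in `K(X_a)` has a resolution, and the landed comparison
  `stub_ofNormalizationIn` (finite birational map `Y^{K(X_a)} → X_a`) transfers it to `X_a`.

Sources: M. Temkin, *Inseparable local uniformization*, J. Algebra 373 (2013), Rem. 1.3.5 (ii)
(the local model `A₀[t]/(t^p - a)`); the algebra is folklore. Mathlib searched and used: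
`AdjoinRoot.lift`, `AdjoinRoot.adjoinRoot_eq_top`, `IsAlgClosed.exists_pow_nat_eq`,
`add_pow_char`, `nilradical_le_prime`, `RingHom.ker_isPrime`,
`IntermediateField.isPurelyInseparable_adjoin_simple_iff_pow_mem`,
`IsPurelyInseparable.finrank_eq_pow`, `IntermediateField.adjoin.finrank`, `minpoly.min`,
`IsFinite.SpecMap_iff`, `HasRingHomProperty.Spec_iff`; the tree's `RatFn.functionFieldMap_SpecMap`,
`RatFn.isDominant_SpecMap_of_injective`, `FunctionFieldOver`, `Scheme.isRegular_Spec` and the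
landed stubs `stub_functionField_normalizationIn`, `stub_baseCase`, `stub_ofNormalizationIn`.
No new definitions.
-/

noncomputable section

set_option linter.dupNamespace false -- mandated namespace of this single-conjunct summit

open CategoryTheory AlgebraicGeometry TopologicalSpace Polynomial
open Literature.AlgebraicGeometry.Resolution Literature.AlgebraicGeometry.Motives

namespace Summit.ResolutionOfSingularities.ResolutionOfSingularities.Theorems.Picover.LocalModelOfDegP

/-! ## Field theory: an extension generated by a `p`-th root -/

/-- **A finite extension generated by one element `x` with `x ^ p ∈ F` (`char F = p`) is purely
inseparable of degree `1` or `p`**: `F(x)/F` is purely inseparable since `x^p ∈ F` (Mathlib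
`IntermediateField.isPurelyInseparable_adjoin_simple_iff_pow_mem`), so `[L : F]` is a power of
`p` (`IsPurelyInseparable.finrank_eq_pow`), and `[F(x) : F] = deg minpoly_F(x) ≤ deg (X^p - c) = p`.
[folklore] -/
theorem isPurelyInseparable_and_finrank_of_pow_mem {F L : Type} [Field F] [Field L] [Algebra F L]
    [FiniteDimensional F L] {p : ℕ} (hp : p.Prime) [CharP F p] {x : L} {c : F}
    (hx : x ^ p = algebraMap F L c) (hgen : IntermediateField.adjoin F {x} = ⊤) :
    IsPurelyInseparable F L ∧ (Module.finrank F L = 1 ∨ Module.finrank F L = p) := by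
  haveI : ExpChar F p := ExpChar.prime hp
  have hpi : IsPurelyInseparable F (IntermediateField.adjoin F {x}) :=
    (IntermediateField.isPurelyInseparable_adjoin_simple_iff_pow_mem F L p).2
      ⟨1, by rw [pow_one, hx]; exact ⟨c, rfl⟩⟩
  rw [hgen] at hpi
  haveI : IsPurelyInseparable F L := IntermediateField.topEquiv.isPurelyInseparable
  refine ⟨this, ?_⟩
  -- `[L : F] = [F(x) : F] = deg minpoly(x) ≤ p`
  have hle : Module.finrank F L ≤ p := by
    have hint : IsIntegral F x := .of_finite F x
    have hmin := minpoly.min F x (monic_X_pow_sub_C c hp.ne_zero)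
      (by rw [map_sub, map_pow, aeval_X, aeval_C, hx, sub_self])
    rw [degree_X_pow_sub_C hp.pos] at hmin
    rw [← IntermediateField.finrank_top', ← hgen, IntermediateField.adjoin.finrank hint]
    exact natDegree_le_iff_degree_le.mpr hmin
  -- `[L : F] = p ^ n ≤ p` forces `n ≤ 1`
  obtain ⟨n, hn⟩ := IsPurelyInseparable.finrank_eq_pow F L p
  have hn1 : n ≤ 1 := by
    have hle' : p ^ n ≤ p ^ 1 := by rw [pow_one]; exact hn.symm.trans_le hle
    exact (pow_le_pow_iff_right₀ hp.one_lt).1 hle'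
  rcases n with _ | _ | n
  · exact Or.inl (hn.trans (pow_zero p))
  · exact Or.inr (hn.trans (pow_one p))
  · exfalso
    omega

/-! ## Commutative algebra of `S = R[T]/(T^p - a)` in characteristic `p` -/

section Algebra

variable {p : ℕ} {R : Type} [CommRing R] (a : R)

/-- **Frobenius lands in `R`**: over a domain `R` of prime characteristic `p`, every element `s`
of `S = R[T]/(T^p - a)` has `s ^ p ∈ R` — for `s = Σ cᵢ tⁱ`, `s^p = Σ cᵢ^p aⁱ` since `t^p = a`
and the `p`-th power map is additive. [folklore] -/
theorem exists_pow_eq_of (hp : p.Prime) [CharP R p] [IsDomain R]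
    (s : AdjoinRoot ((X : R[X]) ^ p - C a)) :
    ∃ c : R, s ^ p = AdjoinRoot.of ((X : R[X]) ^ p - C a) c := by
  have hinj : Function.Injective (AdjoinRoot.of ((X : R[X]) ^ p - C a)) :=
    AdjoinRoot.of.injective_of_degree_ne_zero
      (by rw [degree_X_pow_sub_C hp.pos]; exact_mod_cast hp.ne_zero)
  haveI : CharP (AdjoinRoot ((X : R[X]) ^ p - C a)) p := charP_of_injective_ringHom hinj p
  haveI : Fact p.Prime := ⟨hp⟩
  have hs : s ∈ Algebra.adjoin R ({AdjoinRoot.root ((X : R[X]) ^ p - C a)} : Set _) := by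
    rw [AdjoinRoot.adjoinRoot_eq_top]; trivial
  induction hs using Algebra.adjoin_induction with
  | mem x hx =>
    rw [Set.mem_singleton_iff] at hx
    subst hx
    refine ⟨a, ?_⟩
    have h := AdjoinRoot.eval₂_root ((X : R[X]) ^ p - C a)
    rwa [eval₂_sub, eval₂_X_pow, eval₂_C, sub_eq_zero] at h
  | algebraMap r => exact ⟨r ^ p, by rw [AdjoinRoot.algebraMap_eq, map_pow]⟩
  | add x y _ _ hx hy =>
    obtain ⟨c, hc⟩ := hx
    obtain ⟨d, hd⟩ := hy
    exact ⟨c + d, by rw [add_pow_char, hc, hd, map_add]⟩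
  | mul x y _ _ hx hy =>
    obtain ⟨c, hc⟩ := hx
    obtain ⟨d, hd⟩ := hy
    exact ⟨c * d, by rw [mul_pow, hc, hd, map_mul]⟩

/-- **The nilradical of `S = R[T]/(T^p - a)` is prime** (`R` a domain of prime characteristic
`p`), i.e. `(R[T]/(T^p - a))_red` is a domain: send `T` to a `p`-th root `y` of `a` in an
algebraic closure `Ω` of `Frac R`; the kernel of `S → Ω` is prime and equals the nilradical, for
if `s ↦ 0` then `s^p ∈ R` (`exists_pow_eq_of`) maps to `0` in `Ω`, so `s^p = 0`. [folklore] -/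
theorem isPrime_nilradical_adjoinRoot (hp : p.Prime) [CharP R p] [IsDomain R] :
    (nilradical (AdjoinRoot ((X : R[X]) ^ p - C a))).IsPrime := by
  obtain ⟨i, hi⟩ : ∃ i : R →+* AlgebraicClosure (FractionRing R), Function.Injective i :=
    ⟨(algebraMap (FractionRing R) _).comp (algebraMap R (FractionRing R)),
      (algebraMap (FractionRing R) (AlgebraicClosure (FractionRing R))).injective.comp
        (IsFractionRing.injective R (FractionRing R))⟩
  obtain ⟨y, hy⟩ := IsAlgClosed.exists_pow_nat_eq (i a) hp.pos
  have hroot : ((X : R[X]) ^ p - C a).eval₂ i y = 0 := by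
    rw [eval₂_sub, eval₂_X_pow, eval₂_C, hy, sub_self]
  haveI hprime : (RingHom.ker (AdjoinRoot.lift i y hroot)).IsPrime := RingHom.ker_isPrime _
  suffices h : nilradical (AdjoinRoot ((X : R[X]) ^ p - C a)) =
      RingHom.ker (AdjoinRoot.lift i y hroot) by rwa [h]
  refine le_antisymm (nilradical_le_prime _) fun s hs => ?_
  rw [RingHom.mem_ker] at hs
  obtain ⟨c, hc⟩ := exists_pow_eq_of a hp s
  have hc0 : i c = 0 := by
    have h := congrArg (AdjoinRoot.lift i y hroot) hc
    rw [map_pow, hs, zero_pow hp.ne_zero, AdjoinRoot.lift_of] at h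
    exact h.symm
  obtain rfl : c = 0 := hi (by rw [hc0, map_zero])
  exact mem_nilradical.mpr ⟨p, by rw [hc, map_zero]⟩

/-- `R → S/nil(S)` is injective when `R → S` is injective and `R` is reduced. [folklore] -/
theorem algebraMap_quotient_nilradical_injective {S : Type} [CommRing S] [Algebra R S]
    [IsReduced R] (hinj : Function.Injective (algebraMap R S)) :
    Function.Injective (algebraMap R (S ⧸ nilradical S)) := by
  rw [injective_iff_map_eq_zero]
  intro r hr
  change Ideal.Quotient.mk (nilradical S) (algebraMap R S r) = 0 at hr
  rw [Ideal.Quotient.eq_zero_iff_mem, mem_nilradical] at hr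
  obtain ⟨n, hn⟩ := hr
  rw [← map_pow, map_eq_zero_iff _ hinj] at hn
  exact IsReduced.eq_zero r ⟨n, hn⟩

end Algebra

/-! ## Geometry: `Spec Q → Spec R` for a monogenic finite extension `Q = R[t]`, `t ^ p ∈ R` -/

/-- **Resolution of `Spec R[t]`, `t^p = a ∈ R`, from the degree-`p` residue.** Let `k` be a field
of characteristic `p`, `R` a domain of characteristic `p` with `Spec R` regular and locally of
finite type over `k`, and `φ : R → Q` an injective finite ring map onto a domain `Q` generated
over `R` by one element `t` with `t ^ p = φ a`. Then `Spec Q` has a resolution: `K(Spec Q)` is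
generated over `K(Spec R)` by `t` (`RatFn.functionFieldMap_SpecMap`), hence purely inseparable of
degree `1` or `p` (`isPurelyInseparable_and_finrank_of_pow_mem`); the normalization of `Spec R`
in it has a resolution by the base case (`stub_baseCase`) resp. the residue `hDegP`, and the
finite birational comparison (`stub_ofNormalizationIn`) transfers it to `Spec Q`.
[cite: Temkin2013, Rem. 1.3.5 (ii)] -/
theorem hasResolution_Spec_of_pow_eq
    (hDegP : ∀ (p : ℕ), p.Prime → ∀ (k : Type) [Field k] [CharP k p] (W : Scheme.{0})
      [IsIntegral W] (f : W ⟶ Spec (.of k)) (L : Type) [Field L] [Algebra W.functionField L],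
      IsSeparated f → LocallyOfFiniteType f → QuasiCompact f → Scheme.IsRegular W →
        IsPurelyInseparable W.functionField L → Module.finrank W.functionField L = p →
          Scheme.HasResolution (normalizationIn W L))
    {p : ℕ} (hp : p.Prime) (k : Type) [Field k] [CharP k p] {R Q : CommRingCat.{0}} [IsDomain R]
    [IsDomain Q] [CharP R p] (f : Spec R ⟶ Spec (.of k)) [LocallyOfFiniteType f]
    (hreg : Scheme.IsRegular (Spec R)) (φ : R ⟶ Q) [IsFinite (Spec.map φ)]
    (hφ : Function.Injective φ.hom) {t : Q} {a : R} (ht : t ^ p = φ.hom a)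
    (hgen : ∀ q : Q, ∃ P : R[X], P.eval₂ φ.hom t = q) :
    Scheme.HasResolution (Spec Q) := by
  haveI : IsDominant (Spec.map φ) := RatFn.isDominant_SpecMap_of_injective φ hφ
  haveI : CharP (Spec R).functionField p :=
    charP_of_injective_algebraMap (IsFractionRing.injective R (Spec R).functionField) p
  -- `ψ : Q → K(Spec Q) = L`, an extension of `K(Spec R)` through `(Spec φ)^♯`
  obtain ⟨ψ, hψ⟩ : ∃ ψ : Q →+* FunctionFieldOver (Spec.map φ),
      ∀ q, ψ q = FunctionFieldOver.of (Spec.map φ) (algebraMap Q (Spec Q).functionField q) :=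
    ⟨(FunctionFieldOver.of (Spec.map φ)).toRingHom.comp (algebraMap Q (Spec Q).functionField),
      fun _ => rfl⟩
  -- compatibility `(Spec φ)^♯ ∘ (R → K(Spec R)) = ψ ∘ φ`
  have hcomp : ∀ r : R, algebraMap (Spec R).functionField (FunctionFieldOver (Spec.map φ))
      (algebraMap R (Spec R).functionField r) = ψ (φ.hom r) := by
    intro r
    rw [FunctionFieldOver.algebraMap_apply, RatFn.functionFieldMap_SpecMap, hψ]
  -- the generator `x = ψ t` satisfies `x ^ p ∈ K(Spec R)` …
  have hx : ψ t ^ p = algebraMap (Spec R).functionField (FunctionFieldOver (Spec.map φ))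
      (algebraMap R (Spec R).functionField a) := by
    rw [hcomp, ← map_pow, ht]
  -- … and generates `L` over `K(Spec R)`: first `ψ(Q) ⊆ K(Spec R)(x)` …
  have hmem : ∀ q : Q, ψ q ∈ IntermediateField.adjoin (Spec R).functionField {ψ t} := by
    intro q
    obtain ⟨P, rfl⟩ := hgen q
    have hc : ψ.comp φ.hom = (algebraMap (Spec R).functionField
        (FunctionFieldOver (Spec.map φ))).comp (algebraMap R (Spec R).functionField) :=
      RingHom.ext fun r => (hcomp r).symm
    rw [hom_eval₂, hc, ← eval₂_map, ← aeval_def]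
    exact IntermediateField.algebra_adjoin_le_adjoin _ _ (aeval_mem_adjoin_singleton _ _)
  -- … then `L = Frac Q = K(Spec R)(x)`
  have hgen' : IntermediateField.adjoin (Spec R).functionField {ψ t} = ⊤ := by
    rw [eq_top_iff]
    rintro y -
    obtain ⟨u, v, -, rfl⟩ :=
      IsFractionRing.div_surjective (A := Q) (show (Spec Q).functionField from y)
    change FunctionFieldOver.of (Spec.map φ)
      (algebraMap Q (Spec Q).functionField u / algebraMap Q (Spec Q).functionField v) ∈ _
    rw [map_div₀, ← hψ, ← hψ]
    exact div_mem (hmem u) (hmem v)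
  obtain ⟨hpi, hrank⟩ := isPurelyInseparable_and_finrank_of_pow_mem hp hx hgen'
  -- the normalization of `Spec R` in `L` has a resolution: base case or residue
  have hK := FunctionFieldNormalizationIn.stub_functionField_normalizationIn (Spec R)
    (FunctionFieldOver (Spec.map φ))
  have hN : Scheme.HasResolution (normalizationIn (Spec R) (FunctionFieldOver (Spec.map φ))) := by
    rcases hrank with h1 | hP
    · exact BaseCase.stub_baseCase (Spec R) (FunctionFieldOver (Spec.map φ)) hK hreg h1
    · exact hDegP p hp k (Spec R) f (FunctionFieldOver (Spec.map φ)) inferInstance inferInstance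
        inferInstance hreg hpi hP
  -- transfer along the finite birational comparison `(Spec R)^L → Spec Q`
  exact OfNormalizationIn.stub_ofNormalizationIn k (Spec Q) (Spec R) f (Spec.map φ) hK hN

/-! ## The sub-goal -/

/-- **Sub-goal `picoverLocalModel_of_picoverDegP`** of the line `degree-p-tower`: the degree-`p`
residue (normalizations of regular varieties in degree-`p` purely inseparable extensions of their
function fields have resolutions) implies the local model `PicoverLocalModel` (the reduced
hypersurface `t^p = a` over a regular finitely generated `k`-domain `R` has a resolution), via
`hasResolution_Spec_of_pow_eq` applied to `Q = (R[T]/(T^p - a))_red`, a domain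
(`isPrime_nilradical_adjoinRoot`) finite over `R`, generated by the class of `T`.
[cite: Temkin2013, Rem. 1.3.5 (ii)] -/
theorem picoverLocalModel_of_picoverDegP : (∀ (p : ℕ), p.Prime → ∀ (k : Type) [Field k] [CharP k p] (W : Scheme.{0}) [IsIntegral W] (f : W ⟶ Spec (.of k)) (L : Type) [Field L] [Algebra W.functionField L], IsSeparated f → LocallyOfFiniteType f → QuasiCompact f → Scheme.IsRegular W → IsPurelyInseparable W.functionField L → Module.finrank W.functionField L = p → Scheme.HasResolution (normalizationIn W L)) → Summit.ResolutionOfSingularities.ResolutionOfSingularities.Theses.PAlteration.PicoverLocalModel := by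
  intro hDegP p hp k _ _ R _ _ _ hft hreg a
  haveI : Fact p.Prime := ⟨hp⟩
  haveI : CharP R p := charP_of_injective_algebraMap (algebraMap k R).injective p
  haveI := hft
  haveI := hreg
  -- `S = R[T]/(T^p - a)` is finite free over `R`, `R → S` is injective, `nil(S)` is prime
  have hinjS : Function.Injective (algebraMap R (AdjoinRoot ((X : R[X]) ^ p - C a))) := by
    rw [AdjoinRoot.algebraMap_eq]
    exact AdjoinRoot.of.injective_of_degree_ne_zero
      (by rw [degree_X_pow_sub_C hp.pos]; exact_mod_cast hp.ne_zero)
  haveI : Module.Finite R (AdjoinRoot ((X : R[X]) ^ p - C a)) :=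
    (AdjoinRoot.powerBasis' (monic_X_pow_sub_C a hp.ne_zero)).finite
  haveI : Module.Finite R
      (AdjoinRoot ((X : R[X]) ^ p - C a) ⧸ nilradical (AdjoinRoot ((X : R[X]) ^ p - C a))) :=
    Module.Finite.trans (AdjoinRoot ((X : R[X]) ^ p - C a)) _
  haveI := isPrime_nilradical_adjoinRoot a hp
  haveI : IsDomain
      (AdjoinRoot ((X : R[X]) ^ p - C a) ⧸ nilradical (AdjoinRoot ((X : R[X]) ^ p - C a))) :=
    Ideal.Quotient.isDomain _
  -- the structure morphisms `Spec R → Spec k` and `g : Spec Q → Spec R`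
  haveI : LocallyOfFiniteType (Spec.map (CommRingCat.ofHom (algebraMap k R))) := by
    rw [HasRingHomProperty.Spec_iff (P := @LocallyOfFiniteType), CommRingCat.hom_ofHom]
    exact RingHom.finiteType_algebraMap.mpr hft
  haveI : IsFinite (Spec.map (CommRingCat.ofHom (algebraMap R
      (AdjoinRoot ((X : R[X]) ^ p - C a) ⧸ nilradical (AdjoinRoot ((X : R[X]) ^ p - C a)))))) := by
    rw [IsFinite.SpecMap_iff, CommRingCat.hom_ofHom]
    exact RingHom.finite_algebraMap.mpr inferInstance
  -- the class `t` of `T`: `t ^ p = a`, and `Q = R[t]`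
  have hroot : AdjoinRoot.root ((X : R[X]) ^ p - C a) ^ p = AdjoinRoot.of _ a := by
    have h := AdjoinRoot.eval₂_root ((X : R[X]) ^ p - C a)
    rwa [eval₂_sub, eval₂_X_pow, eval₂_C, sub_eq_zero] at h
  refine hasResolution_Spec_of_pow_eq hDegP hp k (Spec.map (CommRingCat.ofHom (algebraMap k R)))
    (Scheme.isRegular_Spec (.of R)) (CommRingCat.ofHom (algebraMap R _))
    (algebraMap_quotient_nilradical_injective hinjS)
    (t := Ideal.Quotient.mk _ (AdjoinRoot.root _)) (a := a) ?_ ?_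
  · change Ideal.Quotient.mk _ (AdjoinRoot.root _) ^ p =
      Ideal.Quotient.mk _ (algebraMap R (AdjoinRoot ((X : R[X]) ^ p - C a)) a)
    rw [← map_pow, hroot, AdjoinRoot.algebraMap_eq]
  · intro q
    obtain ⟨s, rfl⟩ := Ideal.Quotient.mk_surjective q
    obtain ⟨P, rfl⟩ := AdjoinRoot.mk_surjective s
    refine ⟨P, ?_⟩
    change P.eval₂ ((Ideal.Quotient.mk _).comp (algebraMap R (AdjoinRoot ((X : R[X]) ^ p - C a))))
      (Ideal.Quotient.mk _ (AdjoinRoot.root _)) = _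
    rw [← hom_eval₂, ← aeval_def, AdjoinRoot.aeval_eq]

end Summit.ResolutionOfSingularities.ResolutionOfSingularities.Theorems.Picover.LocalModelOfDegP

end
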